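import Summits.QuantumFields.YangMills.Theorems.UnitScaleTiltProp7SectET3DeltaPiT3Rows
import HarnessLib

/-!
# Route `UnitScaleTilt`, crux «MinimiserStabilityRegPr» (stmt-QuantumFields-19200, stub EX) ∕ (O″χ) B0 (stmt-QuantumFields-20520), node N06(d = 3), route (α) —
# LAYER 0, ROWS (def-free), L0e PART 3: **(3.124)₁ `RD*GQ* = 0` AND THE LANDAU MEMBERS OF THE EX DISPLAY FOR THE LAYER-0 LETTERS** — `R_S(U₀)D*_{U₀}(HY) = 0` ((45)₂ of `h46tw` ∕ `h129L`),
# `R_S(U₀)D*_{U₀}(𝔊f) = 0` (`h102L`, [Balaban1985Variational] (102) «RD*𝔊 = 0») — by an inner-product form of the `B6Eq231` mechanism that needs NO self-adjointness of the Hessian letter, only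
# that its RANGE is orthogonal to the residual pure gauges (`⟪D_{U₀}λ, Δx w⟫ = 0`, `λ ∈ N_S` — true for print's `Δ_π = PᵀΔP` since `P(Dλ) = 0`), on the classes `PosOnto` (∧ `PosPrime` for `Δ_π`)

Cell `ym-inputs` (desk `pub/ym-inputs`, INPUT-LIST.md v6 §4 row p01; memo `pub/ym-inputs/DEFINER-MEMO-T3.md` §2 L0e).  THEOREMS ONLY (0 `def`, 0 `sorry`); `--supports stmt-QuantumFields-20520
--as helper`; count-neutral.  YM₃ on T³ is ladder rung R3, NOT the Clay problem; nothing here is a claim about a stub, a crux, d = 4 or the mass gap.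

THE PRINT.  [Balaban1985BackgroundPropagators] (3.110) p.417 «R(U)D*A = 0»; (3.124) p.420 «RD*GQ* = 0, hence QGDR = 0»; (3.126); [Balaban1985Variational] (45) p.285 «RD*HB = 0», p.294 «Q𝔊 = 0, RD*𝔊 = 0»,
(102) p.293, (129) p.297.

THE MECHANISM (inner-product form).  For `λ₀ ∈ N_S` and every `w`: `⟪Dλ₀, Δ_a w⟫ = ⟪Dλ₀, Δx w⟫ + ⟪Dλ₀, DR_SD*w⟫ + ⟪Dλ₀, Q*aQw⟫ = 0 + ⟪D Δ^ηλ₀, w⟫ + 0` (orthogonality hypothesis; `D* = D†`, `R_S`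
symmetric fixing `Δ^ηN_S`; `QDλ₀ = 0`).  With `R_Sf = Δ^ηλ₀`: `⟪s… ⟫`: `⟪f′, R_SD*GQ*y⟫ = ⟪DR_Sf′, GQ*y⟫ = ⟪Dλ₀, Δ_aGQ*y⟫ = ⟪Dλ₀, Q*y⟫ = ⟪QDλ₀, y⟫ = 0` for every `f′` — hence (3.124)₁.

WHAT IS PROVED (member `F`, `h : n ≤ K`, parameters `c₀ cB a`, letter `Δx`; `hp : PosOnto … Δx U₀`; `hΔ' : ∀ λ ∈ N_S, ∀ w, ⟪D_{U₀}λ, Δx U₀ w⟫ = 0`):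
`inner_DL2_laplaceA` (the display above), ★★★`RS_DstarL2_GT_adjoint` ((3.124)₁ `R_SD*GQ_k† = 0`), ★★`RS_DstarL2_HT` («`RD*HB = 0`», (45)₂ ∕ (3.110) for the layer-0 `H`), ★★`RS_DstarL2_frakGT`
(«`RD*𝔊 = 0`»), `inner_DL2_DeltaPi_eq_zero` (`hΔ'` DISCHARGED for `Δ_π` on `PosPrime`), and for the LETTERS OF RECORD at `Δx := DeltaPiSlot` in the `IsLandauPrintS` shape `R_S(D*(toL2 X)) = 0`
on the route carriers: ★★★`landauS_H46` (`X := H46 … U₀ Y`, the `h46tw` letter — (45)₂), ★★★`landauS_iota_H1f` (`X := ι(H₁f B)` — `h129L`), ★★★`landauS_iota_frakGfR` (`X := ι(𝒢f f)` — `h102L`), modulo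
`PosOnto ∧ PosPrime` ONLY.
HONEST SCOPE.  Finite-dimensional algebra on the displayed classes; no positivity proved; nothing of print asserted; `IsLandauPrintS` itself is the (α-S) seat's definition — these rows are
stated in its announced shape `RS … U₀ (DstarL2 … U₀ (toL2 F K c₀ X)) = 0`.

References: T. Bałaban, CMP **99** (1985) 389–434 [Balaban1985BackgroundPropagators] ((3.110) p.417, (3.124)–(3.126) p.420); CMP **102** (1985) 277–309 [Balaban1985Variational] ((45) p.285,
(102) p.293, p.294, (129) p.297); CMP **96** (1984) 223–250 [Balaban1984PropagatorsII] ((2.34) p.228).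
-/

set_option autoImplicit false

noncomputable section

open scoped InnerProductSpace ComplexConjugate Matrix.Norms.L2Operator

namespace Summit.QuantumFields.YangMills.Theorems.Prop7SectET3DeltaPi

open Literature.MathematicalPhysics.QuantumFieldTheory.Balaban1983to89
open Literature.MathematicalPhysics.QuantumFieldTheory.Balaban1983to89.T3ContinuumYM3Torus
open T3SectALandauChart (eta)
open B9SectCLatticeCarrier (Bond)
open B9Eq311L2Pairing (WL2)
open B11Eq115Space (NegSize Space115 JetSup NegSup)
open B11Eq111FrakG (apply_RDstar_frakGLin)
open B11Eq103H1Complex (SiteL2K BondL2K)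
open Summit.QuantumFields.YangMills.Theorems.Prop7SectET3Transport (periodsT3 bondEquiv bgOfCfg)
open Summit.QuantumFields.YangMills.Theorems.Prop7SectET3HilbertLetters (W₂ frobEquiv toL2 toL2B QL2 DL2 DstarL2 covLapSite adjoint_DL2)
open Summit.QuantumFields.YangMills.Theorems.Prop7SectET3GaugeProjector (QDS NS RS mem_NS_iff QL2_DL2_eq_zero_of_mem_NS RS_apply_covLapSite_of_mem exists_mem_NS_RS_eq RS_isSymmetric)
open Summit.QuantumFields.YangMills.Theorems.Prop7SectET3CurvedPropagators

variable {F : T3Family} {n K : ℕ} {h : n ≤ K} {c₀ cB a : ℝ} [Fact (0 < c₀)] [Fact (0 < cB)]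
  {Δx : GaugeField (F.P K) 0 (Matrix.specialUnitaryGroup (Fin 2) ℂ) → (BondL2K ℂ 3 (periodsT3 F K) c₀ W₂ →ₗ[ℂ] BondL2K ℂ 3 (periodsT3 F K) c₀ W₂)}

/-! ## §1 The inner-product mechanism and (3.124)₁ -/

/-- **`⟪Dλ, Δ_a w⟫ = ⟪D(Δ^ηλ), w⟫` FOR `λ ∈ N_S(U₀)`**, when the range of the Hessian letter is orthogonal to `D N_S` (`hΔ'`): the `DR_SD*` term transposes through `D* = D†`, the symmetric `R_S`
fixing `Δ^ηN_S`; the `Q*aQ` term dies on `QDλ = 0`. [cite: Balaban1985BackgroundPropagators, (3.124) p.420; Balaban1984PropagatorsII, (2.31) p.227] -/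
theorem inner_DL2_laplaceA {U₀ : GaugeField (F.P K) 0 (Matrix.specialUnitaryGroup (Fin 2) ℂ)}
    (hΔ' : ∀ l ∈ NS F n K h c₀ cB U₀, ∀ w, ⟪DL2 F n K c₀ U₀ l, Δx U₀ w⟫_ℂ = 0) {l : SiteL2K ℂ 3 (periodsT3 F K) c₀ W₂} (hl : l ∈ NS F n K h c₀ cB U₀)
    (w : BondL2K ℂ 3 (periodsT3 F K) c₀ W₂) :
    ⟪DL2 F n K c₀ U₀ l, laplaceA F n K h c₀ cB a Δx U₀ w⟫_ℂ = ⟪DL2 F n K c₀ U₀ (covLapSite F n K c₀ U₀ l), w⟫_ℂ := by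
  have hQ : Qk F n K h c₀ cB U₀ (DL2 F n K c₀ U₀ l) = 0 := by
    rw [Qk, LinearMap.smul_apply, QL2_DL2_eq_zero_of_mem_NS U₀ hl, smul_zero]
  rw [laplaceA_apply, inner_add_right, inner_add_right, hΔ' l hl, zero_add, LinearMap.adjoint_inner_right, hQ, inner_zero_left, add_zero,
    ← adjoint_DL2, ← LinearMap.adjoint_inner_left, adjoint_DL2]
  -- `⟪D*Dλ, R_S(D†w)⟫ = ⟪R_S(Δ^ηλ), D†w⟫ = ⟪Δ^ηλ, D†w⟫ = ⟪D(Δ^ηλ), w⟫`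
  rw [← LinearMap.comp_apply (DstarL2 F n K c₀ U₀) (DL2 F n K c₀ U₀) l, show DstarL2 F n K c₀ U₀ ∘ₗ DL2 F n K c₀ U₀ = covLapSite F n K c₀ U₀ from rfl,
    ← RS_isSymmetric U₀ _ _, RS_apply_covLapSite_of_mem U₀ hl, ← adjoint_DL2, LinearMap.adjoint_inner_right]

/-- ★★★ **(3.124)₁ AT THE MEMBER: `R_S D* G Q_k† = 0`** on the class, for a Hessian letter whose range is orthogonal to the residual pure gauges — NO self-adjointness of the letter is used.
[cite: Balaban1985BackgroundPropagators, (3.124) p.420; Balaban1984PropagatorsII, (2.34) p.228] -/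
theorem RS_DstarL2_GT_adjoint {U₀ : GaugeField (F.P K) 0 (Matrix.specialUnitaryGroup (Fin 2) ℂ)} (hp : PosOnto F n K h c₀ cB a Δx U₀)
    (hΔ' : ∀ l ∈ NS F n K h c₀ cB U₀, ∀ w, ⟪DL2 F n K c₀ U₀ l, Δx U₀ w⟫_ℂ = 0) (y : WL2 ℂ (fun _ : PBond (F.P n) 0 => cB) W₂) :
    RS F n K h c₀ cB U₀ (DstarL2 F n K c₀ U₀ (GT F n K h c₀ cB a Δx U₀ (LinearMap.adjoint (Qk F n K h c₀ cB U₀) y))) = 0 := by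
  refine ext_inner_left ℂ fun s => ?_
  obtain ⟨l, hl, hs⟩ := exists_mem_NS_RS_eq U₀ s
  have hQ : Qk F n K h c₀ cB U₀ (DL2 F n K c₀ U₀ l) = 0 := by
    rw [Qk, LinearMap.smul_apply, QL2_DL2_eq_zero_of_mem_NS U₀ hl, smul_zero]
  rw [inner_zero_right, ← RS_isSymmetric U₀ _ _, hs, ← adjoint_DL2, LinearMap.adjoint_inner_right, ← inner_DL2_laplaceA (a := a) hΔ' hl,
    laplaceA_GT hp, LinearMap.adjoint_inner_right, hQ, inner_zero_left]

/-- ★★ **«`RD*HB = 0`» FOR THE LAYER-0 `H = GQ*(QGQ*)⁻¹` ON THE CLASS** ((45)₂ ∕ (3.110)). [cite: Balaban1985Variational, (45) p.285; Balaban1985BackgroundPropagators, (3.110) p.417, (3.126) p.420] -/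
theorem RS_DstarL2_HT {U₀ : GaugeField (F.P K) 0 (Matrix.specialUnitaryGroup (Fin 2) ℂ)} (hp : PosOnto F n K h c₀ cB a Δx U₀)
    (hΔ' : ∀ l ∈ NS F n K h c₀ cB U₀, ∀ w, ⟪DL2 F n K c₀ U₀ l, Δx U₀ w⟫_ℂ = 0) (B : WL2 ℂ (fun _ : PBond (F.P n) 0 => cB) W₂) :
    RS F n K h c₀ cB U₀ (DstarL2 F n K c₀ U₀ (HT F n K h c₀ cB a Δx U₀ B)) = 0 := by
  rw [HT_eq_comp hp, LinearMap.comp_apply, LinearMap.comp_apply]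
  exact RS_DstarL2_GT_adjoint hp hΔ' _

/-- ★★ **«`RD*𝔊 = 0`» FOR THE LAYER-0 `𝔊 = G𝔓*` ON THE CLASS** (lit-balaban's `apply_RDstar_frakGLin` with `h124'` and `hRDR` DISCHARGED). [cite: Balaban1985Variational, p.294, (102) p.293] -/
theorem RS_DstarL2_frakGT {U₀ : GaugeField (F.P K) 0 (Matrix.specialUnitaryGroup (Fin 2) ℂ)} (hp : PosOnto F n K h c₀ cB a Δx U₀)
    (hΔ : ∀ l ∈ NS F n K h c₀ cB U₀, Δx U₀ (DL2 F n K c₀ U₀ l) = 0) (hΔ' : ∀ l ∈ NS F n K h c₀ cB U₀, ∀ w, ⟪DL2 F n K c₀ U₀ l, Δx U₀ w⟫_ℂ = 0)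
    (x : BondL2K ℂ 3 (periodsT3 F K) c₀ W₂) :
    RS F n K h c₀ cB U₀ (DstarL2 F n K c₀ U₀ (frakGT F n K h c₀ cB a Δx U₀ x)) = 0 :=
  apply_RDstar_frakGLin (RS_DstarL2_GT_adjoint hp hΔ') (RS_DstarL2_GT_DL2_RS hp hΔ) x

/-! ## §2 `Δ_π`: the orthogonality hypothesis discharged, and the Landau members for the letters of record -/

/-- **FOR `Δ_π = PᵀΔ^ηP` THE RANGE IS ORTHOGONAL TO `D N_S`**: `⟪Dλ, Δ_π w⟫ = ⟪P(Dλ), Δ^η(Pw)⟫ = 0` (`P(Dλ) = 0`, ✓`gaugeCorr_DL2_of_mem_NS`), on `PosPrime`.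
[cite: Balaban1985BackgroundPropagators, (3.119) p.419] -/
theorem inner_DL2_DeltaPi_eq_zero {U₀ : GaugeField (F.P K) 0 (Matrix.specialUnitaryGroup (Fin 2) ℂ)} (hq : PosPrime F n K h c₀ cB a U₀) :
    ∀ l ∈ NS F n K h c₀ cB U₀, ∀ w, ⟪DL2 F n K c₀ U₀ l, DeltaPiSlot F n K h c₀ cB a U₀ w⟫_ℂ = 0 := by
  intro l hl w
  rw [DeltaPiSlot_apply, inner_DeltaPi, gaugeCorr_DL2_of_mem_NS hq hl, inner_zero_left]

/-- ★★★ **(45)₂ FOR THE `h46tw` LETTER OF RECORD, `IsLandauPrintS` SHAPE: `R_S(D*_{U₀}(toL2 (H46 Y))) = 0`** modulo `PosOnto ∧ PosPrime`.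
[cite: Balaban1985Variational, (45) p.285; Balaban1985BackgroundPropagators, (3.110) p.417, (3.126) p.420] -/
theorem landauS_H46 {U₀ : GaugeField (F.P K) 0 (Matrix.specialUnitaryGroup (Fin 2) ℂ)} (hp : PosOnto F n K h c₀ cB a (DeltaPiSlot F n K h c₀ cB a) U₀)
    (hq : PosPrime F n K h c₀ cB a U₀) (Y : PBond (F.P n) 0 → Matrix (Fin 2) (Fin 2) ℂ) :
    RS F n K h c₀ cB U₀ (DstarL2 F n K c₀ U₀ (toL2 F K c₀ (H46 F n K h c₀ cB a U₀ Y))) = 0 := by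
  rw [H46, Hf_apply, map_smul, LinearEquiv.apply_symm_apply, map_smul, map_smul, RS_DstarL2_HT hp (inner_DL2_DeltaPi_eq_zero hq), smul_zero]

/-- ★★★ **`h129L` FOR THE LETTER `H₁f := H1f … DeltaPiSlot`, `IsLandauPrintS` SHAPE: `R_S(D*_{U₀}(toL2 (ι(H₁f B)))) = 0`** modulo `PosOnto ∧ PosPrime`.
[cite: Balaban1985Variational, (129) p.297, (45) p.285; Balaban1985BackgroundPropagators, (3.124) p.420] -/
theorem landauS_iota_H1f [Fact (0 < (F.L : ℝ))] [Fact (0 < ((F.L : ℝ)⁻¹) ^ (K - n))] {U₀ : GaugeField (F.P K) 0 (Matrix.specialUnitaryGroup (Fin 2) ℂ)}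
    (hp : PosOnto F n K h c₀ cB a (DeltaPiSlot F n K h c₀ cB a) U₀) (hq : PosPrime F n K h c₀ cB a U₀) (B : PBond (F.P n) 0 → Matrix (Fin 2) (Fin 2) ℂ) :
    RS F n K h c₀ cB U₀ (DstarL2 F n K c₀ U₀ (toL2 F K c₀
      (fun b : PBond (F.P K) 0 => JetSup.equiv _ _ _ (H1f F n K h c₀ cB a (DeltaPiSlot F n K h c₀ cB a) U₀ B) (bondEquiv F K b)))) = 0 := by
  rw [iota_H1f_eq, LinearEquiv.apply_symm_apply]
  exact RS_DstarL2_HT hp (inner_DL2_DeltaPi_eq_zero hq) _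

/-- ★★★ **`h102L` FOR THE READER OF RECORD `𝒢f := frakGfR … DeltaPiSlot`, `IsLandauPrintS` SHAPE: `R_S(D*_{U₀}(toL2 (ι(𝒢f f)))) = 0`** modulo `PosOnto ∧ PosPrime`.
[cite: Balaban1985Variational, (102) p.293, p.294; Balaban1985BackgroundPropagators, (3.124) p.420, (3.147) p.425] -/
theorem landauS_iota_frakGfR [Fact (0 < (F.L : ℝ))] [Fact (0 < ((F.L : ℝ)⁻¹) ^ (K - n))] {U₀ : GaugeField (F.P K) 0 (Matrix.specialUnitaryGroup (Fin 2) ℂ)}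
    (hp : PosOnto F n K h c₀ cB a (DeltaPiSlot F n K h c₀ cB a) U₀) (hq : PosPrime F n K h c₀ cB a U₀)
    (f : NegSize (F.L : ℝ) (((F.L : ℝ)⁻¹) ^ (K - n)) (fun _ : Bond 3 (periodsT3 F K) => K - n) 3 (Matrix (Fin 2) (Fin 2) ℂ)) :
    RS F n K h c₀ cB U₀ (DstarL2 F n K c₀ U₀ (toL2 F K c₀
      (fun b : PBond (F.P K) 0 => JetSup.equiv _ _ _ (frakGfR F n K h c₀ cB a (DeltaPiSlot F n K h c₀ cB a) U₀ f) (bondEquiv F K b)))) = 0 := by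
  rw [iota_frakGfR_eq, LinearEquiv.apply_symm_apply]
  exact RS_DstarL2_frakGT hp (DeltaPiSlot_kills_NS hq) (inner_DL2_DeltaPi_eq_zero hq) _

end Summit.QuantumFields.YangMills.Theorems.Prop7SectET3DeltaPi

end
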